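import Mathlib.Analysis.Calculus.MeanValue
import Mathlib.Analysis.Calculus.ParametricIntegral
import Mathlib.MeasureTheory.Integral.Bochner.Set
import HarnessLib

/-!
# Zero-mean functions with small directional derivatives are small
(Borel, *Automorphic forms on `SL₂(ℝ)`* (1997), §7.4 "Main lemma" and Thm. 7.5, PDF pp. 60–62 of
the held copy; Harish-Chandra, *Automorphic Forms on Semisimple Lie Groups*, LNM 62 (1968),
Ch. I §4; Moeglin–Waldspurger, *Spectral Decomposition and Eisenstein Series* (1995), §I.2)

The elementary real-analysis core of the estimate "a cusp form has rapid decay" (Borel's main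
lemma 7.4: `|(f - f_P)(x)| ≤ c · a(x)^{-α} Σᵢ |Xᵢ f|_P(x)`, proved by writing
`(f_P - f)(x) = ∫₀¹ (f(e^{tY} x) - f(x)) dt` and `f(e^{tY}x) - f(x) = ∫₀ᵗ ((-Y) * f)(e^{uY} x) du`,
then iterated in Thm. 7.5): on a compact piece `𝓕` of the unipotent quotient, a function with
**zero mean** is bounded by its **oscillation**, and the oscillation along the (archimedean)
lines `t ↦ X + ι(t v)` is bounded by the length of the segment times the size of the derivative.
Here only this abstract skeleton is proved, in the generality of an additive group `E` (the adelic
points of the unipotent radical; no real vector space structure on `E` is assumed — the reals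
act only through an additive map `ι : V →+ E` from a real normed space of directions), so that it
can be iterated along words of directions, the torus rescaling of the derivatives being supplied
by the consumer:

* `norm_le_of_setIntegral_eq_zero_of_norm_sub_le` — if `∫_𝓕 F = 0` with `0 < ν(𝓕) < ∞` and
  `‖F x - F y‖ ≤ δ` for all `y ∈ 𝓕`, then `‖F x‖ ≤ δ`.
* `norm_sub_le_of_hasDerivAt_lines` — if `t ↦ F (X + ι(t bᵢ))` has derivative
  `Gᵢ (X + ι(t bᵢ))` everywhere with `‖Gᵢ‖ ≤ M`, then
  `‖F (X + ι(Σ_{i<m} cᵢ bᵢ)) - F X‖ ≤ (Σ_{i<m} |cᵢ|) M` (telescoping and the mean value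
  inequality on each segment).
* `norm_le_of_setIntegral_eq_zero_of_repr` — combining the two with an invariance group `Λ` and
  **bounded representatives** (`Y = X + λ + ι(Σ cᵢ bᵢ)` with `λ ∈ Λ`, `|cᵢ| ≤ L`): a
  `Λ`-invariant `F` with zero mean on `𝓕` satisfies `‖F‖ ≤ m L M` everywhere.
* `setIntegral_eq_zero_of_hasDerivAt_of_forall_setIntegral_eq` — **derivatives of functions with
  translation-invariant means have zero mean**: if `t ↦ ∫_𝓕 F(X + ι(t v)) dν(X)` is constant
  (e.g. `ν` is invariant and `𝓕` is a fundamental domain for a lattice of periods of `F`) and the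
  derivative `G` along `v` is bounded and measurable, then `∫_𝓕 G = 0` (differentiation under the
  integral sign, `hasDerivAt_integral_of_dominated_loc_of_deriv_le`), so that the first three
  lemmas can be iterated along words of directions.

## References

* A. Borel, *Automorphic forms on `SL₂(ℝ)`*, Cambridge Tracts in Math. 130 (1997), §7.1
  (constant term), 7.4 (main lemma), 7.5–7.6 (iteration; `f * φ - (f * φ)_P` rapidly
  decreasing), PDF pp. 60–62 of `book:borelnd-automorphic-forms-sl2-r` [Borel1997].
* Harish-Chandra, *Automorphic Forms on Semisimple Lie Groups*, LNM 62 (1968), Ch. I §4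
  [HarishChandra1968].
* C. Moeglin, J.-L. Waldspurger, *Spectral Decomposition and Eisenstein Series*, Cambridge Tracts
  in Math. 113 (1995), §I.2 [MoeglinWaldspurger1995].
-/

noncomputable section

open MeasureTheory Set Filter Metric
open scoped Topology ENNReal

namespace Literature.Analysis.Calculus

/-! ### Zero mean and bounded oscillation -/

section ZeroMean

variable {E : Type*} [MeasurableSpace E] {F' : Type*} [NormedAddCommGroup F'] [NormedSpace ℝ F']
  [CompleteSpace F']

/-- **A function with zero mean is bounded by its oscillation.** If `∫_𝓕 F dν = 0` with
`0 < ν(𝓕) < ∞`, `F` integrable on `𝓕`, and `‖F x - F y‖ ≤ δ` for all `y ∈ 𝓕`, then `‖F x‖ ≤ δ`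
(average the inequality over `y ∈ 𝓕`). [folklore] -/
theorem norm_le_of_setIntegral_eq_zero_of_norm_sub_le {ν : Measure E} {𝓕 : Set E}
    (h𝓕0 : ν 𝓕 ≠ 0) (h𝓕t : ν 𝓕 ≠ ∞) {F : E → F'} (hF : IntegrableOn F 𝓕 ν)
    (h0 : ∫ y in 𝓕, F y ∂ν = 0) {x : E} {δ : ℝ} (hosc : ∀ y ∈ 𝓕, ‖F x - F y‖ ≤ δ) :
    ‖F x‖ ≤ δ := by
  have hpos : 0 < ν.real 𝓕 := ENNReal.toReal_pos h𝓕0 h𝓕t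
  haveI : IsFiniteMeasure (ν.restrict 𝓕) := ⟨by rwa [Measure.restrict_apply_univ, lt_top_iff_ne_top]⟩
  -- `(ν 𝓕) • F x = ∫_𝓕 (F x - F y) dy`
  have h1 : ∫ y in 𝓕, (F x - F y) ∂ν = (ν.real 𝓕) • F x := by
    rw [integral_sub (integrable_const _) hF, h0, sub_zero, setIntegral_const]
  have h2 : ‖∫ y in 𝓕, (F x - F y) ∂ν‖ ≤ δ * ν.real 𝓕 :=
    norm_setIntegral_le_of_norm_le_const h𝓕t.lt_top fun y hy => hosc y hy
  rw [h1, norm_smul, Real.norm_eq_abs, abs_of_pos hpos, mul_comm] at h2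
  exact le_of_mul_le_mul_right h2 hpos

end ZeroMean

/-! ### Oscillation along lines with bounded derivative -/

section Lines

variable {E : Type*} [AddCommGroup E] {V : Type*} [NormedAddCommGroup V] [NormedSpace ℝ V]
  {F' : Type*} [NormedAddCommGroup F'] [NormedSpace ℝ F']

/-- **One segment.** If `t ↦ F (X + ι(t v))` has derivative `G (X + ι(t v))` at every `t` and
`‖G‖ ≤ M`, then `‖F (X + ι(c v)) - F X‖ ≤ |c| M` (mean value inequality on `[0, c]`).
[folklore] -/
theorem norm_sub_le_of_hasDerivAt_line (ι : V →+ E) {F G : E → F'} {v : V} {M : ℝ}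
    (hderiv : ∀ (X : E) (s : ℝ),
      HasDerivAt (fun t : ℝ => F (X + ι (t • v))) (G (X + ι (s • v))) s)
    (hG : ∀ X, ‖G X‖ ≤ M) (X : E) (c : ℝ) :
    ‖F (X + ι (c • v)) - F X‖ ≤ |c| * M := by
  have key : ∀ x ∈ (Set.univ : Set ℝ), HasDerivWithinAt (fun t : ℝ => F (X + ι (t • v)))
      (G (X + ι (x • v))) Set.univ x := fun x _ => (hderiv X x).hasDerivWithinAt
  have h := Convex.norm_image_sub_le_of_norm_hasDerivWithin_le key (fun x _ => hG _)
    convex_univ (Set.mem_univ (0 : ℝ)) (Set.mem_univ c)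
  simp only [zero_smul, map_zero, add_zero, sub_zero, Real.norm_eq_abs] at h
  rw [mul_comm] at h
  exact h

/-- **Telescoping along finitely many lines.** If for each `i` the function
`t ↦ F (X + ι(t bᵢ))` has derivative `Gᵢ (X + ι(t bᵢ))` everywhere (every base point `X`) with
`‖Gᵢ‖ ≤ M`, then `‖F (X + ι(Σ_{i<m} cᵢ bᵢ)) - F X‖ ≤ (Σ_{i<m} |cᵢ|) M`. [folklore] -/
theorem norm_sub_le_of_hasDerivAt_lines (ι : V →+ E) {F : E → F'} {b : ℕ → V}
    {G : ℕ → E → F'} {M : ℝ}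
    (hderiv : ∀ (i : ℕ) (X : E) (s : ℝ),
      HasDerivAt (fun t : ℝ => F (X + ι (t • b i))) (G i (X + ι (s • b i))) s)
    (hG : ∀ i X, ‖G i X‖ ≤ M) (X : E) (c : ℕ → ℝ) (m : ℕ) :
    ‖F (X + ι (∑ i ∈ Finset.range m, c i • b i)) - F X‖ ≤
      (∑ i ∈ Finset.range m, |c i|) * M := by
  induction m with
  | zero => simp
  | succ m ih =>
    rw [Finset.sum_range_succ, Finset.sum_range_succ, map_add, ← add_assoc, add_mul]
    calc ‖F (X + ι (∑ i ∈ Finset.range m, c i • b i) + ι (c m • b m)) - F X‖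
        ≤ ‖F (X + ι (∑ i ∈ Finset.range m, c i • b i) + ι (c m • b m)) -
            F (X + ι (∑ i ∈ Finset.range m, c i • b i))‖ +
          ‖F (X + ι (∑ i ∈ Finset.range m, c i • b i)) - F X‖ := norm_sub_le_norm_sub_add_norm_sub _ _ _
      _ ≤ |c m| * M + (∑ i ∈ Finset.range m, |c i|) * M :=
          add_le_add (norm_sub_le_of_hasDerivAt_line ι (hderiv m) (hG m) _ _) ih
      _ = (∑ i ∈ Finset.range m, |c i|) * M + |c m| * M := add_comm _ _

/-- **Zero mean plus bounded representatives.** Let `F : E → F'` be invariant under a subgroup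
`Λ` (`F (X + λ) = F X`), have zero mean on a set `𝓕` with `0 < ν(𝓕) < ∞`, and have derivatives
`Gᵢ` along the lines `t ↦ X + ι(t bᵢ)`, `i < m`, bounded by `M ≥ 0`. If every `Y` is
`X + λ + ι(Σ_{i<m} cᵢ bᵢ)` with `λ ∈ Λ` and `|cᵢ| ≤ L`, then `‖F X‖ ≤ m L M` for every `X`
(the skeleton of Borel (1997), main lemma 7.4, PDF p. 61: `f_P - f` is an average of
`f(e^{tY}x) - f(x)`, itself an integral of the derivative along `Y`).
[cite: Borel1997, Lemma 7.4 (PDF pp. 60–61)] -/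
theorem norm_le_of_setIntegral_eq_zero_of_repr [MeasurableSpace E] [CompleteSpace F']
    {ν : Measure E} {𝓕 : Set E} (h𝓕0 : ν 𝓕 ≠ 0) (h𝓕t : ν 𝓕 ≠ ∞)
    (ι : V →+ E) {F : E → F'} (hF : IntegrableOn F 𝓕 ν) (h0 : ∫ y in 𝓕, F y ∂ν = 0)
    {Λ : AddSubgroup E} (hΛ : ∀ l ∈ Λ, ∀ X, F (X + l) = F X)
    {b : ℕ → V} {G : ℕ → E → F'} {M : ℝ} (hM : 0 ≤ M)
    (hderiv : ∀ (i : ℕ) (X : E) (s : ℝ),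
      HasDerivAt (fun t : ℝ => F (X + ι (t • b i))) (G i (X + ι (s • b i))) s)
    (hG : ∀ i X, ‖G i X‖ ≤ M) {m : ℕ} {L : ℝ}
    (hrepr : ∀ X Y : E, ∃ l ∈ Λ, ∃ c : ℕ → ℝ, (∀ i, |c i| ≤ L) ∧
      Y = X + l + ι (∑ i ∈ Finset.range m, c i • b i)) (X : E) :
    ‖F X‖ ≤ m * L * M := by
  refine norm_le_of_setIntegral_eq_zero_of_norm_sub_le h𝓕0 h𝓕t hF h0 fun Y _ => ?_
  obtain ⟨l, hl, c, hc, rfl⟩ := hrepr X Y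
  have e : F (X + l + ι (∑ i ∈ Finset.range m, c i • b i)) =
      F (X + ι (∑ i ∈ Finset.range m, c i • b i)) := by
    rw [add_right_comm, hΛ l hl]
  rw [e, norm_sub_rev]
  refine (norm_sub_le_of_hasDerivAt_lines ι hderiv hG X c m).trans ?_
  have hsum : ∑ i ∈ Finset.range m, |c i| ≤ m * L := by
    calc ∑ i ∈ Finset.range m, |c i| ≤ ∑ _i ∈ Finset.range m, L := Finset.sum_le_sum fun i _ => hc i
      _ = m * L := by rw [Finset.sum_const, Finset.card_range, nsmul_eq_mul]
  exact mul_le_mul_of_nonneg_right hsum hM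

end Lines

/-! ### Derivatives of functions with invariant means have zero mean -/

section DerivMean

variable {E : Type*} [AddCommGroup E] [MeasurableSpace E] {V : Type*} [NormedAddCommGroup V]
  [NormedSpace ℝ V] {F' : Type*} [NormedAddCommGroup F'] [NormedSpace ℝ F']

/-- **The derivative along `v` of a function whose means over `𝓕` are translation invariant has
zero mean over `𝓕`.** Let `t ↦ F (X + ι(t v))` have derivative `G (X + ι(t v))` at every `t`,
with `G` bounded and the translates `X ↦ F (X + ι(t v))`, `X ↦ G (X + ι(t v))` measurable on
`𝓕`, `ν(𝓕) < ∞`, `F` integrable on `𝓕`. If `∫_𝓕 F(X + ι(t v)) dν(X)` does not depend on `t`,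
then `∫_𝓕 G dν = 0`: the constant function `t ↦ ∫_𝓕 F(X + ι(t v)) dν(X)` has derivative
`∫_𝓕 G` at `t = 0` by differentiation under the integral sign. (The hypothesis holds when `ν`
is translation invariant, `F` is periodic under a lattice `Λ` and `𝓕` is a fundamental domain for
`Λ`: the integral over `𝓕` of a periodic function is its integral over the quotient.) [folklore] -/
theorem setIntegral_eq_zero_of_hasDerivAt_of_forall_setIntegral_eq {ν : Measure E} {𝓕 : Set E}
    (h𝓕t : ν 𝓕 ≠ ∞) (ι : V →+ E) {F G : E → F'} {v : V} {M : ℝ}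
    (hderiv : ∀ (X : E) (s : ℝ),
      HasDerivAt (fun t : ℝ => F (X + ι (t • v))) (G (X + ι (s • v))) s)
    (hG : ∀ X, ‖G X‖ ≤ M)
    (hFm : ∀ t : ℝ, AEStronglyMeasurable (fun X => F (X + ι (t • v))) (ν.restrict 𝓕))
    (hGm : AEStronglyMeasurable G (ν.restrict 𝓕))
    (hF : IntegrableOn F 𝓕 ν)
    (hconst : ∀ t : ℝ, ∫ X in 𝓕, F (X + ι (t • v)) ∂ν = ∫ X in 𝓕, F X ∂ν) :
    ∫ X in 𝓕, G X ∂ν = 0 := by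
  haveI : IsFiniteMeasure (ν.restrict 𝓕) := ⟨by rwa [Measure.restrict_apply_univ, lt_top_iff_ne_top]⟩
  -- differentiate under the integral sign at `t = 0`
  have hball : ball (0 : ℝ) 1 ∈ 𝓝 (0 : ℝ) := ball_mem_nhds _ one_pos
  have hF0 : Integrable (fun X => F (X + ι ((0 : ℝ) • v))) (ν.restrict 𝓕) := by
    simp only [zero_smul, map_zero, add_zero]
    exact hF
  have hG0 : AEStronglyMeasurable (fun X => G (X + ι ((0 : ℝ) • v))) (ν.restrict 𝓕) := by
    simpa using hGm
  have h := hasDerivAt_integral_of_dominated_loc_of_deriv_le (μ := ν.restrict 𝓕)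
    (F := fun (t : ℝ) (X : E) => F (X + ι (t • v)))
    (F' := fun (t : ℝ) (X : E) => G (X + ι (t • v))) (x₀ := (0 : ℝ)) (bound := fun _ => M)
    hball (Eventually.of_forall hFm) hF0 hG0
    (Eventually.of_forall fun X t _ => hG _) (integrable_const M)
    (Eventually.of_forall fun X t _ => hderiv X t)
  have hD : HasDerivAt (fun t : ℝ => ∫ X in 𝓕, F (X + ι (t • v)) ∂ν)
      (∫ X in 𝓕, G (X + ι ((0 : ℝ) • v)) ∂ν) 0 := h.2
  simp only [zero_smul, map_zero, add_zero] at hD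
  -- but the function is constant
  have hC : HasDerivAt (fun t : ℝ => ∫ X in 𝓕, F (X + ι (t • v)) ∂ν) 0 0 := by
    have : (fun t : ℝ => ∫ X in 𝓕, F (X + ι (t • v)) ∂ν) = fun _ => ∫ X in 𝓕, F X ∂ν :=
      funext hconst
    rw [this]
    exact hasDerivAt_const _ _
  exact hD.unique hC

end DerivMean

end Literature.Analysis.Calculus
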